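import Summits.QuantumFields.BalabanUV.Beta.EriceFlowEnclosureB12AsPrintedHistoryContagionShiftFlowRepinPicard
import Summits.QuantumFields.BalabanUV.Beta.EriceRemainderEnclosureHistoryAutonomyOrder

/-!
# Beta / EriceFlowEnclosureB12AsPrintedHistoryContagionShiftFlowRepinTail — ASYMPTOTIC FREEDOM IS CONTAGIOUS, part 25: RE-PINNING ALONG THE TRAJECTORY — THE SOLUTION
# COCYCLE, AND EVENTUAL WELL-POSEDNESS ALONG EVERY ASYMPTOTICALLY FREE TRAJECTORY WITH NO SMALLNESS.  The functional is scale-independent, so the ultraviolet tail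
# `(t(n), t(n+1), …)` of a box solution t of `MemFlow B g* ·` solves the SAME flow from the pin t(n) (d4-p2's `EriceRemainderEnclosureHistoryAutonomyOrder.memFlow_tail`,
# BY NAME), and the tail of an asymptotically free reference with profile `1∕t_a² + β*·m` is an asymptotically free reference with the SMALLER scale
# `t_a^{(n)} = 1∕√(1∕t_a² + β*·n)` and the SAME rate (§35).  Parts 23–24 at the reference pin therefore apply to every tail, with hypotheses that only IMPROVE along the
# trajectory: (§36) under the n = 0 smallness (`2t_a ≤ γ`, `4C_m t_a ≤ β*(1 − θ)`, `t_a²K ≤ ½`, `16C_m t_a³ < (1 − θ)²` resp. `64C_m t_a³ ≤ (1 − θ)²`) the flow RE-PINNED AT ANY OF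
# THE TRAJECTORY'S OWN RUNNING VALUES t(n) has the tail as its ONLY box solution (`memFlow_unique_tail`), node U2's `solution B (t n)` IS that tail (`solution_tail_eq`), and
# node U2's solution operator satisfies THE COCYCLE ∕ SEMIGROUP LAW `solution B (solution B g* n) m = solution B g* (n + m)` (`solution_cocycle`, also from a pin strictly
# below a reference, `solution_cocycle_of_reference`) — d4-p2's AUTONOMY identity `(S p)(n + ·) = S (S p n)` (their §2, WITH the floor `b ≤ B`) floor-free near zero pin —
# so THE TRAJECTORY IS THE ORBIT OF ONE MAP ON COUPLING SPACE, `solution B g* n = R^[n] g*` with the lattice-free one-step renormalization map `R g = solution B g 1`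
# (`solution_eq_orbit`; d4-p2's `family_eq_iterate` floor-free);
# (§37) WITH NO SMALLNESS AT ALL: for EVERY box ]0, γ], EVERY memory profile (C_m, θ < 1) and EVERY asymptotically free box solution t (any pin, any t_a, any β* > 0) there
# is a physical scale n₀ beyond which re-pinning at t(n) is well posed — the tail is the unique box solution from t(n), equal to node U2's `solution B (t n)`, computed
# by node U2's lattice-free Picard iteration from the constant history t(n) (`eventually_wellPosed_tail`): the decay `1∕t(n)² ≥ 1∕t_a² + β*·n` supplies every smallness
# the theory needs.  Part 26 reads §36 on the as-printed carrier (Theorem 2's continuum trajectory is RG-invariant).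
# Abstract in B (β-flow team, prover 1, unit `b2b-balaban-beta-bflow-p1`, gen 38; ROW AP-I·Uc × NODE U2)

HONEST FRAMING (page 1 of everything the β sub-cell writes): discharging `BetaPertH` makes Bałaban's UV stability UNCONDITIONAL — a
real constructive-QFT result; it is NOT the continuum limit and NOT the Clay problem.  HONEST DEPENDENCY (cell reorg 2026-08-19,
verbatim): «continuum YM on T⁴ ⇐ BetaPertH ∧ nine spine estimates (0/9 proved); BetaPertH ⇐ (D1) ∧ (D4) ∧ CAP+tail; G-an2-4 gates
asym, D1 and NE2/3/4.»  THIS MODULE DISCHARGES NOTHING: [folklore] real analysis (index shifts, one Archimedean choice, monotonicity of four smallness conditions in the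
reference scale) over node U2's HYPOTHESIS SHAPES `T4BetaStationary.{SeqBox, MemoryProfile}`, `T4BetaFlowWellPosed.{MemFlow, iterate, solution}` on an ABSTRACT functional
`B : (ℕ → ℝ) → ℝ` — node U2's hypothesis shapes, which node U2 derives for Bałaban's limit functional from NE4 ∕ moduli LETTERS (NOT PRINTED for [I] = T. Bałaban, Commun.
Math. Phys. **109** (1987) [Balaban1987RG1]: GAPS G-t4-U2-1 ∕ -2; the reference profile is the shape of (0.31)'s lower half, Theorem 2 p. 259, STATED WITHOUT PROOF, in the
continuum; p. 298 says only that β_j depends on the preceding couplings).  Nothing of Bałaban's β is asserted; node U2's `seqBox_shift ∕ iterate ∕ solution`, node U2's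
`T4CouplingMatching.{prof, sprof, sprof_zero, sprof_sq}`, d4-p2's `memFlow_tail` and parts 23–24 are USED BY NAME; nothing of theirs is restated or modified.

WHAT THIS FILE PROVES (0 sorry, 0 def): §35 `one_div_sprof_pos`, `invSq_one_div_sprof`, `one_div_sprof_le`, **`tail_profile`**, `smallness_mono`, `exists_tail_scale_le`,
`repin_threshold_exists`; §36 **`memFlow_unique_tail`**, `existsUnique_memFlow_tail`, **`solution_tail_eq`**, `tendsto_iterate_tail`, **`solution_cocycle`**,
**`solution_eq_orbit`** (`solution B g* n = R^[n] g*`, `R g = solution B g 1`), **`solution_cocycle_of_reference`**, `existsUnique_memFlow_along_solution`,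
`solution_eq_orbit_of_reference`; §37 **`eventually_wellPosed_tail`**.  NOT CLAIMED: anything about Bałaban's β; well-posedness at
EVERY scale of an arbitrary AF trajectory (false in general without smallness: node U2's §7 bump, part 28); the carrier reading (part 26); `BetaPertH`; the continuum limit of
the measures; Clay.
-/

namespace Summit.QuantumFields.BalabanUV.Beta.EriceFlowEnclosureB12AsPrintedHistoryContagionShiftFlowRepinTail

open Finset Filter Topology
open Literature.MathematicalPhysics.QuantumFieldTheory.Balaban1983to89
open Literature.MathematicalPhysics.QuantumFieldTheory.Balaban1983to89.T4CouplingMatching (prof sprof sprof_pos sprof_sq prof_pos sprof_zero)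
open Literature.MathematicalPhysics.QuantumFieldTheory.Balaban1983to89.T4BetaStationary (SeqBox MemoryProfile)
open Literature.MathematicalPhysics.QuantumFieldTheory.Balaban1983to89.T4BetaFlowWellPosed (MemFlow iterate solution seqBox_shift)
open Summit.QuantumFields.BalabanUV.Beta.EriceFlowEnclosureB12AsPrintedHistoryContagion (sprof_le_sprof)
open Summit.QuantumFields.BalabanUV.Beta.EriceRemainderEnclosureHistoryAutonomyOrder (memFlow_tail)
open Summit.QuantumFields.BalabanUV.Beta.EriceFlowEnclosureB12AsPrintedHistoryContagionShiftFlowPicardLimit (memFlow_solution_of_reference)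
open Summit.QuantumFields.BalabanUV.Beta.EriceFlowEnclosureB12AsPrintedHistoryContagionShiftFlowRepin (memFlow_unique_at_reference le_of_profile)
open Summit.QuantumFields.BalabanUV.Beta.EriceFlowEnclosureB12AsPrintedHistoryContagionShiftFlowRepinPicard (memFlow_solution_at_reference solution_eq_at_reference
  tendsto_iterate_at_reference)

noncomputable section

/-! ## §35 The tail of an asymptotically free reference is an asymptotically free reference with a smaller scale -/

/-- The tail scale `t_a^{(n)} = 1∕√(1∕t_a² + β*·n)` is positive. [folklore] -/
theorem one_div_sprof_pos {ta bs : ℝ} (hta : 0 < ta) (hbs : 0 ≤ bs) (n : ℕ) : 0 < 1 / sprof ta bs n :=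
  one_div_pos.mpr (sprof_pos hta hbs n)

/-- The chart value of the tail scale: `1∕(t_a^{(n)})² = 1∕t_a² + β*·n`. [folklore] -/
theorem invSq_one_div_sprof {ta bs : ℝ} (hta : 0 < ta) (hbs : 0 ≤ bs) (n : ℕ) :
    1 / (1 / sprof ta bs n) ^ 2 = 1 / ta ^ 2 + bs * (n : ℝ) := by
  rw [one_div_pow, one_div_one_div, sprof_sq hta hbs]
  rfl

/-- The tail scale is below the reference scale: `t_a^{(n)} ≤ t_a`. [folklore] -/
theorem one_div_sprof_le {ta bs : ℝ} (hta : 0 < ta) (hbs : 0 ≤ bs) (n : ℕ) : 1 / sprof ta bs n ≤ ta := by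
  calc 1 / sprof ta bs n ≤ 1 / sprof ta bs 0 := one_div_le_one_div_of_le (sprof_pos hta hbs 0) (sprof_le_sprof hbs (Nat.zero_le n))
    _ = ta := by rw [sprof_zero hta, one_div_one_div]

/-- **THE TAIL OF AN AF REFERENCE IS AN AF REFERENCE**: if `1∕t_a² + β*·m ≤ 1∕t(m)²` for all m then, for every n, `1∕(t_a^{(n)})² + β*·m ≤ 1∕t(n + m)²` for all m — the same
rate β*, the smaller scale `t_a^{(n)} = 1∕√(1∕t_a² + β*·n)`. [cite: Balaban1987RG1, Thm 2 (0.31) p.259] -/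
theorem tail_profile {ta bs : ℝ} {t : ℕ → ℝ} (hta : 0 < ta) (hbs : 0 ≤ bs)
    (hprof : ∀ m : ℕ, 1 / ta ^ 2 + bs * (m : ℝ) ≤ 1 / (t m) ^ 2) (n : ℕ) :
    ∀ m : ℕ, 1 / (1 / sprof ta bs n) ^ 2 + bs * (m : ℝ) ≤ 1 / ((fun j => t (n + j)) m) ^ 2 := by
  intro m
  rw [invSq_one_div_sprof hta hbs]
  have h := hprof (n + m)
  push_cast at h
  simp only
  linarith

/-- THE FOUR SMALLNESS CONDITIONS ARE MONOTONE IN THE REFERENCE SCALE: they pass from t_a to every `0 < τ ≤ t_a`. [folklore] -/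
theorem smallness_mono {Cm θ γ bs ta τ : ℝ} (hCm : 0 ≤ Cm) (hτ : 0 < τ) (hτta : τ ≤ ta)
    (h2ta : 2 * ta ≤ γ) (hr1 : 4 * Cm * ta ≤ bs * (1 - θ))
    (hr2 : ta ^ 2 * (Cm * γ / (1 - θ) ^ 2 + (2 * Cm / ((1 - θ) * bs)) ^ 2) ≤ 1 / 2)
    (hr4 : 64 * Cm * ta ^ 3 ≤ (1 - θ) ^ 2) :
    2 * τ ≤ γ ∧ 4 * Cm * τ ≤ bs * (1 - θ) ∧ τ ^ 2 * (Cm * γ / (1 - θ) ^ 2 + (2 * Cm / ((1 - θ) * bs)) ^ 2) ≤ 1 / 2 ∧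
      64 * Cm * τ ^ 3 ≤ (1 - θ) ^ 2 := by
  have hK : 0 ≤ Cm * γ / (1 - θ) ^ 2 + (2 * Cm / ((1 - θ) * bs)) ^ 2 := by
    have hγ : 0 ≤ γ := by linarith
    positivity
  refine ⟨by linarith, (by nlinarith : 4 * Cm * τ ≤ 4 * Cm * ta).trans hr1,
    (mul_le_mul_of_nonneg_right (pow_le_pow_left₀ hτ.le hτta 2) hK).trans hr2,
    (mul_le_mul_of_nonneg_left (pow_le_pow_left₀ hτ.le hτta 3) (by positivity)).trans hr4⟩

/-- THE TAIL SCALE BECOMES ARBITRARILY SMALL (β* > 0): for every δ > 0 there is n₀ with `t_a^{(n)} ≤ δ` for all n ≥ n₀ (Archimedes). [folklore] -/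
theorem exists_tail_scale_le {ta bs δ : ℝ} (hta : 0 < ta) (hbs : 0 < bs) (hδ : 0 < δ) :
    ∃ n₀ : ℕ, ∀ n, n₀ ≤ n → 1 / sprof ta bs n ≤ δ := by
  obtain ⟨n₀, hn₀⟩ := exists_nat_ge (1 / (δ ^ 2 * bs))
  refine ⟨n₀, fun n hn => ?_⟩
  have hn' : 1 / (δ ^ 2 * bs) ≤ (n : ℝ) := hn₀.trans (by exact_mod_cast hn)
  have hbn : 1 / δ ^ 2 ≤ bs * (n : ℝ) := by
    have := mul_le_mul_of_nonneg_left hn' hbs.le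
    rwa [show bs * (1 / (δ ^ 2 * bs)) = 1 / δ ^ 2 by field_simp] at this
  have hprof : (1 / δ) ^ 2 ≤ prof ta bs n := by
    have hta2 : 0 ≤ 1 / ta ^ 2 := by positivity
    have e : prof ta bs n = 1 / ta ^ 2 + bs * (n : ℝ) := rfl
    rw [e, one_div_pow]
    linarith
  have hs : 1 / δ ≤ sprof ta bs n := by
    have := Real.sqrt_le_sqrt hprof
    rwa [Real.sqrt_sq (by positivity)] at this
  calc 1 / sprof ta bs n ≤ 1 / (1 / δ) := one_div_le_one_div_of_le (by positivity) hs
    _ = δ := one_div_one_div δ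

/-- A COMMON THRESHOLD FOR THE FOUR SMALLNESS CONDITIONS: given C_m ≥ 0, θ < 1, γ > 0, β* > 0 there is δ > 0 such that every `0 < τ ≤ δ` has `2τ ≤ γ`, `4C_m τ ≤ β*(1 − θ)`,
`τ²·(C_mγ∕(1 − θ)² + (2C_m∕((1 − θ)β*))²) ≤ ½` and `64C_m τ³ ≤ (1 − θ)²`. [folklore] -/
theorem repin_threshold_exists {Cm θ γ bs : ℝ} (hCm : 0 ≤ Cm) (hθ1 : θ < 1) (hγ : 0 < γ) (hbs : 0 < bs) :
    ∃ δ : ℝ, 0 < δ ∧ ∀ τ : ℝ, 0 < τ → τ ≤ δ → 2 * τ ≤ γ ∧ 4 * Cm * τ ≤ bs * (1 - θ) ∧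
      τ ^ 2 * (Cm * γ / (1 - θ) ^ 2 + (2 * Cm / ((1 - θ) * bs)) ^ 2) ≤ 1 / 2 ∧ 64 * Cm * τ ^ 3 ≤ (1 - θ) ^ 2 := by
  have h1θ : 0 < 1 - θ := by linarith
  set K : ℝ := Cm * γ / (1 - θ) ^ 2 + (2 * Cm / ((1 - θ) * bs)) ^ 2 with hKdef
  have hK : 0 ≤ K := by positivity
  refine ⟨min (γ / 2) (min 1 (min (bs * (1 - θ) / (4 * Cm + 1)) (min (1 / (2 * (K + 1))) ((1 - θ) ^ 2 / (64 * Cm + 1))))),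
    lt_min (by positivity) (lt_min one_pos (lt_min (by positivity) (lt_min (by positivity) (by positivity)))), fun τ hτ hle => ?_⟩
  have h0 : τ ≤ γ / 2 := hle.trans (min_le_left _ _)
  have h1 : τ ≤ 1 := hle.trans ((min_le_right _ _).trans (min_le_left _ _))
  have h2 : τ ≤ bs * (1 - θ) / (4 * Cm + 1) := hle.trans ((min_le_right _ _).trans ((min_le_right _ _).trans (min_le_left _ _)))
  have h3 : τ ≤ 1 / (2 * (K + 1)) :=
    hle.trans ((min_le_right _ _).trans ((min_le_right _ _).trans ((min_le_right _ _).trans (min_le_left _ _))))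
  have h4 : τ ≤ (1 - θ) ^ 2 / (64 * Cm + 1) :=
    hle.trans ((min_le_right _ _).trans ((min_le_right _ _).trans ((min_le_right _ _).trans (min_le_right _ _))))
  refine ⟨by linarith, ?_, ?_, ?_⟩
  · rw [le_div_iff₀ (by positivity)] at h2; nlinarith
  · rw [le_div_iff₀ (by positivity)] at h3
    have hτ2 : τ ^ 2 ≤ τ := by nlinarith
    nlinarith [mul_le_mul_of_nonneg_right hτ2 hK]
  · rw [le_div_iff₀ (by positivity)] at h4
    have hτ3 : τ ^ 3 ≤ τ := by nlinarith [mul_le_mul h1 h1 hτ.le zero_le_one]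
    nlinarith [mul_le_mul_of_nonneg_left hτ3 (by positivity : (0 : ℝ) ≤ 64 * Cm)]

/-! ## §36 Re-pinning along the trajectory: the tail is the unique box solution from t(n); the solution cocycle -/

/-- **RE-PINNING: THE FLOW FROM ANY OF THE TRAJECTORY'S OWN RUNNING VALUES HAS THE TAIL AS ITS ONLY BOX SOLUTION.**  `B` with memory profile `(C_m, θ)` on ]0, γ]^ℕ
(0 ≤ θ < 1, C_m ≥ 0); ONE box solution t of `MemFlow B g* t` with the AF profile `1∕t_a² + β*·m ≤ 1∕t(m)²` (β* > 0, t_a > 0) and the n = 0 smallness `2t_a ≤ γ`,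
`4C_m t_a ≤ β*(1 − θ)`, `t_a²·(C_mγ∕(1 − θ)² + (2C_m∕((1 − θ)β*))²) ≤ ½`, `16C_m t_a³ < (1 − θ)²`.  THEN for EVERY physical scale n, every box solution h of
`MemFlow B (t n) h` IS the tail: `h = (t(n), t(n+1), …)` (part 23's `memFlow_unique_at_reference` for the tail reference, whose scale `t_a^{(n)} ≤ t_a` only improves
the hypotheses). [cite: Balaban1987RG1, Thm 2 (0.31) p.259 with (0.20) p.256 and p.298] -/
theorem memFlow_unique_tail {B : (ℕ → ℝ) → ℝ} {Cm θ γ bs ta gs : ℝ} {t h : ℕ → ℝ}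
    (hB : MemoryProfile Cm θ γ B) (hCm : 0 ≤ Cm) (hθ0 : 0 ≤ θ) (hθ1 : θ < 1) (hbs : 0 < bs) (hta : 0 < ta)
    (hts : SeqBox γ t) (htf : MemFlow B gs t) (hprof : ∀ m : ℕ, 1 / ta ^ 2 + bs * (m : ℝ) ≤ 1 / (t m) ^ 2)
    (h2ta : 2 * ta ≤ γ) (hr1 : 4 * Cm * ta ≤ bs * (1 - θ))
    (hr2 : ta ^ 2 * (Cm * γ / (1 - θ) ^ 2 + (2 * Cm / ((1 - θ) * bs)) ^ 2) ≤ 1 / 2)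
    (hr4 : 16 * Cm * ta ^ 3 < (1 - θ) ^ 2) (n : ℕ) (hhs : SeqBox γ h) (hhf : MemFlow B (t n) h) :
    h = fun j => t (n + j) := by
  have hτ := one_div_sprof_pos hta hbs.le n
  have hτta := one_div_sprof_le hta hbs.le n
  -- transfer the smallness to the tail scale t_a^{(n)} ≤ t_a (the strict condition by hand)
  have hK : 0 ≤ Cm * γ / (1 - θ) ^ 2 + (2 * Cm / ((1 - θ) * bs)) ^ 2 := by
    have hγ : 0 ≤ γ := by linarith
    positivity
  have hr1' : 4 * Cm * (1 / sprof ta bs n) ≤ bs * (1 - θ) := (by nlinarith : 4 * Cm * (1 / sprof ta bs n) ≤ 4 * Cm * ta).trans hr1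
  have hr2' : (1 / sprof ta bs n) ^ 2 * (Cm * γ / (1 - θ) ^ 2 + (2 * Cm / ((1 - θ) * bs)) ^ 2) ≤ 1 / 2 :=
    (mul_le_mul_of_nonneg_right (pow_le_pow_left₀ hτ.le hτta 2) hK).trans hr2
  have hr4' : 16 * Cm * (1 / sprof ta bs n) ^ 3 < (1 - θ) ^ 2 :=
    (mul_le_mul_of_nonneg_left (pow_le_pow_left₀ hτ.le hτta 3) (by positivity)).trans_lt hr4
  exact memFlow_unique_at_reference hB hCm hθ0 hθ1 hbs hτ (seqBox_shift hts n) (memFlow_tail htf n) (tail_profile hta hbs.le hprof n)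
    hhs hhf hr1' hr2' hr4'

/-- … hence **re-pinning at t(n) is well posed**: `∃! h, SeqBox γ h ∧ MemFlow B (t n) h`, for every n. [cite: Balaban1987RG1, Thm 2 (0.31) p.259 with (0.20) p.256 and p.298] -/
theorem existsUnique_memFlow_tail {B : (ℕ → ℝ) → ℝ} {Cm θ γ bs ta gs : ℝ} {t : ℕ → ℝ}
    (hB : MemoryProfile Cm θ γ B) (hCm : 0 ≤ Cm) (hθ0 : 0 ≤ θ) (hθ1 : θ < 1) (hbs : 0 < bs) (hta : 0 < ta)
    (hts : SeqBox γ t) (htf : MemFlow B gs t) (hprof : ∀ m : ℕ, 1 / ta ^ 2 + bs * (m : ℝ) ≤ 1 / (t m) ^ 2)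
    (h2ta : 2 * ta ≤ γ) (hr1 : 4 * Cm * ta ≤ bs * (1 - θ))
    (hr2 : ta ^ 2 * (Cm * γ / (1 - θ) ^ 2 + (2 * Cm / ((1 - θ) * bs)) ^ 2) ≤ 1 / 2)
    (hr4 : 16 * Cm * ta ^ 3 < (1 - θ) ^ 2) (n : ℕ) : ∃! h : ℕ → ℝ, SeqBox γ h ∧ MemFlow B (t n) h :=
  ⟨fun j => t (n + j), ⟨seqBox_shift hts n, memFlow_tail htf n⟩,
    fun _ hh => memFlow_unique_tail hB hCm hθ0 hθ1 hbs hta hts htf hprof h2ta hr1 hr2 hr4 n hh.1 hh.2⟩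

/-- **NODE U2's SOLUTION FROM THE RUNNING VALUE t(n) IS THE TAIL**: under the n = 0 smallness with `64C_m t_a³ ≤ (1 − θ)²` (the Picard contraction), for every n
`solution B (t n) = (t(n), t(n+1), …)` (part 24's `solution_eq_at_reference` for the tail reference). [cite: Balaban1987RG1, Thm 2 (0.31) p.259 with (0.20) p.256 and p.298] -/
theorem solution_tail_eq {B : (ℕ → ℝ) → ℝ} {Cm θ γ bs ta gs : ℝ} {t : ℕ → ℝ}
    (hB : MemoryProfile Cm θ γ B) (hCm : 0 ≤ Cm) (hθ0 : 0 ≤ θ) (hθ1 : θ < 1) (hbs : 0 < bs) (hta : 0 < ta)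
    (hts : SeqBox γ t) (htf : MemFlow B gs t) (hprof : ∀ m : ℕ, 1 / ta ^ 2 + bs * (m : ℝ) ≤ 1 / (t m) ^ 2)
    (h2ta : 2 * ta ≤ γ) (hr1 : 4 * Cm * ta ≤ bs * (1 - θ))
    (hr2 : ta ^ 2 * (Cm * γ / (1 - θ) ^ 2 + (2 * Cm / ((1 - θ) * bs)) ^ 2) ≤ 1 / 2)
    (hr4 : 64 * Cm * ta ^ 3 ≤ (1 - θ) ^ 2) (n : ℕ) : solution B (t n) = fun j => t (n + j) := by
  obtain ⟨h2τ, hr1', hr2', hr4'⟩ := smallness_mono hCm (one_div_sprof_pos hta hbs.le n) (one_div_sprof_le hta hbs.le n) h2ta hr1 hr2 hr4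
  exact solution_eq_at_reference hB hCm hθ0 hθ1 hbs (one_div_sprof_pos hta hbs.le n) (seqBox_shift hts n) (memFlow_tail htf n)
    (tail_profile hta hbs.le hprof n) h2τ hr1' hr2' hr4'

/-- … and node U2's lattice-free iterates from the constant history t(n) COMPUTE THE TAIL: `iterate B (t n) k m → t(n + m)` as k → ∞. [cite: Balaban1987RG1, Thm 2 (0.31) p.259 with (0.20) p.256 and p.298] -/
theorem tendsto_iterate_tail {B : (ℕ → ℝ) → ℝ} {Cm θ γ bs ta gs : ℝ} {t : ℕ → ℝ}
    (hB : MemoryProfile Cm θ γ B) (hCm : 0 ≤ Cm) (hθ0 : 0 ≤ θ) (hθ1 : θ < 1) (hbs : 0 < bs) (hta : 0 < ta)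
    (hts : SeqBox γ t) (htf : MemFlow B gs t) (hprof : ∀ m : ℕ, 1 / ta ^ 2 + bs * (m : ℝ) ≤ 1 / (t m) ^ 2)
    (h2ta : 2 * ta ≤ γ) (hr1 : 4 * Cm * ta ≤ bs * (1 - θ))
    (hr2 : ta ^ 2 * (Cm * γ / (1 - θ) ^ 2 + (2 * Cm / ((1 - θ) * bs)) ^ 2) ≤ 1 / 2)
    (hr4 : 64 * Cm * ta ^ 3 ≤ (1 - θ) ^ 2) (n m : ℕ) : Tendsto (fun k => iterate B (t n) k m) atTop (𝓝 (t (n + m))) := by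
  obtain ⟨h2τ, hr1', hr2', hr4'⟩ := smallness_mono hCm (one_div_sprof_pos hta hbs.le n) (one_div_sprof_le hta hbs.le n) h2ta hr1 hr2 hr4
  exact tendsto_iterate_at_reference hB hCm hθ0 hθ1 hbs (one_div_sprof_pos hta hbs.le n) (seqBox_shift hts n) (memFlow_tail htf n)
    (tail_profile hta hbs.le hprof n) h2τ hr1' hr2' hr4' m

/-- **THE SOLUTION COCYCLE (SEMIGROUP LAW OF NODE U2's SOLUTION OPERATOR, FLOOR-FREE NEAR ZERO PIN).**  `B` with memory profile `(C_m, θ)` on ]0, γ]^ℕ; ONE box solution t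
of `MemFlow B g* t` with the AF profile `1∕t_a² + β*·m ≤ 1∕t(m)²` and the smallness `2t_a ≤ γ`, `4C_m t_a ≤ β*(1 − θ)`, `t_a²K ≤ ½`, `64C_m t_a³ ≤ (1 − θ)²`.  THEN for all n, m:
**`solution B (solution B g* n) m = solution B g* (n + m)`** — evolving n scales into the ultraviolet and re-solving from the value reached is evolving n + m scales
(`solution B g* = t` by part 24, and `solution B (t n)` is the tail).  d4-p2's AUTONOMY identity `(S p)(n + ·) = S (S p n)` (with the floor) near zero pin, floor-free.
[cite: Balaban1987RG1, Thm 2 (0.31) p.259 with (0.20) p.256 and p.298] -/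
theorem solution_cocycle {B : (ℕ → ℝ) → ℝ} {Cm θ γ bs ta gs : ℝ} {t : ℕ → ℝ}
    (hB : MemoryProfile Cm θ γ B) (hCm : 0 ≤ Cm) (hθ0 : 0 ≤ θ) (hθ1 : θ < 1) (hbs : 0 < bs) (hta : 0 < ta)
    (hts : SeqBox γ t) (htf : MemFlow B gs t) (hprof : ∀ m : ℕ, 1 / ta ^ 2 + bs * (m : ℝ) ≤ 1 / (t m) ^ 2)
    (h2ta : 2 * ta ≤ γ) (hr1 : 4 * Cm * ta ≤ bs * (1 - θ))
    (hr2 : ta ^ 2 * (Cm * γ / (1 - θ) ^ 2 + (2 * Cm / ((1 - θ) * bs)) ^ 2) ≤ 1 / 2)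
    (hr4 : 64 * Cm * ta ^ 3 ≤ (1 - θ) ^ 2) (n m : ℕ) : solution B (solution B gs n) m = solution B gs (n + m) := by
  rw [solution_eq_at_reference hB hCm hθ0 hθ1 hbs hta hts htf hprof h2ta hr1 hr2 hr4,
    solution_tail_eq hB hCm hθ0 hθ1 hbs hta hts htf hprof h2ta hr1 hr2 hr4 n]

/-- **THE TRAJECTORY IS THE ORBIT OF ONE MAP ON COUPLING SPACE.**  Under the data of `solution_cocycle`, for every n: **`solution B g* n = R^[n] g*`** with the LATTICE-FREE
ONE-STEP RENORMALIZATION MAP `R g := solution B g 1` (one scale of node U2's solution operator) — despite the memory of the flow, near zero pin its solution is generated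
by iterating a single map of the coupling; d4-p2's `family_eq_iterate` (with the floor) floor-free near zero pin. [cite: Balaban1987RG1, Thm 2 (0.31) p.259 with (0.20) p.256 and p.298] -/
theorem solution_eq_orbit {B : (ℕ → ℝ) → ℝ} {Cm θ γ bs ta gs : ℝ} {t : ℕ → ℝ}
    (hB : MemoryProfile Cm θ γ B) (hCm : 0 ≤ Cm) (hθ0 : 0 ≤ θ) (hθ1 : θ < 1) (hbs : 0 < bs) (hta : 0 < ta)
    (hts : SeqBox γ t) (htf : MemFlow B gs t) (hprof : ∀ m : ℕ, 1 / ta ^ 2 + bs * (m : ℝ) ≤ 1 / (t m) ^ 2)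
    (h2ta : 2 * ta ≤ γ) (hr1 : 4 * Cm * ta ≤ bs * (1 - θ))
    (hr2 : ta ^ 2 * (Cm * γ / (1 - θ) ^ 2 + (2 * Cm / ((1 - θ) * bs)) ^ 2) ≤ 1 / 2)
    (hr4 : 64 * Cm * ta ^ 3 ≤ (1 - θ) ^ 2) : ∀ n : ℕ, solution B gs n = (fun g => solution B g 1)^[n] gs := by
  intro n
  induction n with
  | zero =>
    obtain ⟨-, hsf, -⟩ := memFlow_solution_at_reference hB hCm hθ0 hθ1 hbs hta hts htf hprof h2ta hr1 hr2 hr4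
    rw [Function.iterate_zero_apply]
    exact hsf.1
  | succ n ih =>
    rw [Function.iterate_succ_apply', ← ih]
    exact (solution_cocycle hB hCm hθ0 hθ1 hbs hta hts htf hprof h2ta hr1 hr2 hr4 n 1).symm

/-- **THE SOLUTION COCYCLE FROM A PIN BELOW A REFERENCE.**  `B` with memory profile `(C_m, θ)` on ]0, γ]^ℕ; ONE box solution t of `MemFlow B g* t` with `1∕t_a² + β*·m ≤ 1∕t(m)²`;
a pin `0 < e`, `4e ≤ γ`, with `32C_m e ≤ β*(1 − θ)`, `e²·(1∕g*² + C_mγ∕(1 − θ)² + (2C_m∕((1 − θ)β*))²) ≤ 3∕4`, `4e²·(C_mγ∕(1 − θ)² + (8C_m∕((1 − θ)β*))²) ≤ ½`, `512C_m e³ ≤ (1 − θ)²`.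
THEN node U2's `solution B e` is a box solution with the quarter profile (part 13), it is ITS OWN reference (scale 2e, rate β*∕4), and for all n, m:
`solution B (solution B e n) m = solution B e (n + m)`, every re-pinned flow `MemFlow B (solution B e n) ·` having the tail as its only box solution.
[cite: Balaban1987RG1, Thm 2 (0.31) p.259 with (0.20) p.256 and p.298] -/
theorem solution_cocycle_of_reference {B : (ℕ → ℝ) → ℝ} {Cm θ γ bs ta gs e : ℝ} {t : ℕ → ℝ}
    (hB : MemoryProfile Cm θ γ B) (hCm : 0 ≤ Cm) (hθ0 : 0 ≤ θ) (hθ1 : θ < 1) (hbs : 0 < bs) (hta : 0 < ta)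
    (hts : SeqBox γ t) (htf : MemFlow B gs t) (hprof : ∀ m : ℕ, 1 / ta ^ 2 + bs * (m : ℝ) ≤ 1 / (t m) ^ 2)
    (he : 0 < e) (h4e : 4 * e ≤ γ)
    (hs1 : 32 * Cm * e ≤ bs * (1 - θ))
    (hs2 : e ^ 2 * (1 / gs ^ 2 + Cm * γ / (1 - θ) ^ 2 + (2 * Cm / ((1 - θ) * bs)) ^ 2) ≤ 3 / 4)
    (hs2' : 4 * e ^ 2 * (Cm * γ / (1 - θ) ^ 2 + (8 * Cm / ((1 - θ) * bs)) ^ 2) ≤ 1 / 2)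
    (hs4 : 512 * Cm * e ^ 3 ≤ (1 - θ) ^ 2) (n : ℕ) :
    (∀ m : ℕ, solution B (solution B e n) m = solution B e (n + m)) ∧
      ∀ h : ℕ → ℝ, SeqBox γ h → MemFlow B (solution B e n) h → h = fun j => solution B e (n + j) := by
  have h1θ : 0 < 1 - θ := by linarith
  have h2e : 2 * e ≤ γ := by linarith
  have hs1e : 4 * Cm * e ≤ bs * (1 - θ) := by nlinarith [mul_nonneg hCm he.le]
  have hs4e : 64 * Cm * e ^ 3 ≤ (1 - θ) ^ 2 := by nlinarith [mul_nonneg hCm (pow_nonneg he.le 3)]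
  obtain ⟨hss, hsf, hprofs, -⟩ := memFlow_solution_of_reference hB hCm hθ0 hθ1 hbs hta hts htf hprof he h2e hs1e hs2 hs4e
  -- the solution is its own reference: scale 2e, rate β*∕4
  have h2e0 : 0 < 2 * e := by positivity
  have hb4 : 0 < bs / 4 := by positivity
  have hprof' : ∀ m : ℕ, 1 / (2 * e) ^ 2 + bs / 4 * (m : ℝ) ≤ 1 / (solution B e m) ^ 2 := fun m => by
    have e4 : 1 / (2 * e) ^ 2 = 1 / (4 * e ^ 2) := by ring
    rw [e4]; exact hprofs m
  have h2ta : 2 * (2 * e) ≤ γ := by linarith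
  have hr1 : 4 * Cm * (2 * e) ≤ bs / 4 * (1 - θ) := by linarith
  have hr2 : (2 * e) ^ 2 * (Cm * γ / (1 - θ) ^ 2 + (2 * Cm / ((1 - θ) * (bs / 4))) ^ 2) ≤ 1 / 2 := by
    have e8 : 2 * Cm / ((1 - θ) * (bs / 4)) = 8 * Cm / ((1 - θ) * bs) := by
      field_simp
      ring
    rw [e8]
    calc (2 * e) ^ 2 * (Cm * γ / (1 - θ) ^ 2 + (8 * Cm / ((1 - θ) * bs)) ^ 2)
        = 4 * e ^ 2 * (Cm * γ / (1 - θ) ^ 2 + (8 * Cm / ((1 - θ) * bs)) ^ 2) := by ring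
      _ ≤ 1 / 2 := hs2'
  have hr4 : 64 * Cm * (2 * e) ^ 3 ≤ (1 - θ) ^ 2 := by nlinarith
  have hr4' : 16 * Cm * (2 * e) ^ 3 < (1 - θ) ^ 2 := by
    have : 0 < (1 - θ) ^ 2 := by positivity
    nlinarith [mul_nonneg hCm (pow_nonneg h2e0.le 3)]
  exact ⟨fun m => solution_cocycle hB hCm hθ0 hθ1 hb4 h2e0 hss hsf hprof' h2ta hr1 hr2 hr4 n m,
    fun h hh hf => memFlow_unique_tail hB hCm hθ0 hθ1 hb4 h2e0 hss hsf hprof' h2ta hr1 hr2 hr4' n hh hf⟩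

/-- **WELL-POSEDNESS ALONG THE SOLUTION**: under the data of `solution_cocycle_of_reference`, the flow re-pinned at ANY running value `solution B e n` of node U2's solution
from e has exactly one box solution. [cite: Balaban1987RG1, Thm 2 (0.31) p.259 with (0.20) p.256 and p.298] -/
theorem existsUnique_memFlow_along_solution {B : (ℕ → ℝ) → ℝ} {Cm θ γ bs ta gs e : ℝ} {t : ℕ → ℝ}
    (hB : MemoryProfile Cm θ γ B) (hCm : 0 ≤ Cm) (hθ0 : 0 ≤ θ) (hθ1 : θ < 1) (hbs : 0 < bs) (hta : 0 < ta)
    (hts : SeqBox γ t) (htf : MemFlow B gs t) (hprof : ∀ m : ℕ, 1 / ta ^ 2 + bs * (m : ℝ) ≤ 1 / (t m) ^ 2)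
    (he : 0 < e) (h4e : 4 * e ≤ γ)
    (hs1 : 32 * Cm * e ≤ bs * (1 - θ))
    (hs2 : e ^ 2 * (1 / gs ^ 2 + Cm * γ / (1 - θ) ^ 2 + (2 * Cm / ((1 - θ) * bs)) ^ 2) ≤ 3 / 4)
    (hs2' : 4 * e ^ 2 * (Cm * γ / (1 - θ) ^ 2 + (8 * Cm / ((1 - θ) * bs)) ^ 2) ≤ 1 / 2)
    (hs4 : 512 * Cm * e ^ 3 ≤ (1 - θ) ^ 2) (n : ℕ) : ∃! h : ℕ → ℝ, SeqBox γ h ∧ MemFlow B (solution B e n) h := by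
  have h1θ : 0 < 1 - θ := by linarith
  have h2e : 2 * e ≤ γ := by linarith
  have hs1e : 4 * Cm * e ≤ bs * (1 - θ) := by nlinarith [mul_nonneg hCm he.le]
  have hs4e : 64 * Cm * e ^ 3 ≤ (1 - θ) ^ 2 := by nlinarith [mul_nonneg hCm (pow_nonneg he.le 3)]
  obtain ⟨hss, hsf, -, -⟩ := memFlow_solution_of_reference hB hCm hθ0 hθ1 hbs hta hts htf hprof he h2e hs1e hs2 hs4e
  obtain ⟨-, huniq⟩ := solution_cocycle_of_reference hB hCm hθ0 hθ1 hbs hta hts htf hprof he h4e hs1 hs2 hs2' hs4 n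
  exact ⟨fun j => solution B e (n + j), ⟨seqBox_shift hss n, memFlow_tail hsf n⟩, fun h hh => huniq h hh.1 hh.2⟩

/-- **THE ORBIT FROM A PIN BELOW A REFERENCE**: under the data of `solution_cocycle_of_reference`, `solution B e n = R^[n] e` for every n, `R g := solution B g 1`.
[cite: Balaban1987RG1, Thm 2 (0.31) p.259 with (0.20) p.256 and p.298] -/
theorem solution_eq_orbit_of_reference {B : (ℕ → ℝ) → ℝ} {Cm θ γ bs ta gs e : ℝ} {t : ℕ → ℝ}
    (hB : MemoryProfile Cm θ γ B) (hCm : 0 ≤ Cm) (hθ0 : 0 ≤ θ) (hθ1 : θ < 1) (hbs : 0 < bs) (hta : 0 < ta)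
    (hts : SeqBox γ t) (htf : MemFlow B gs t) (hprof : ∀ m : ℕ, 1 / ta ^ 2 + bs * (m : ℝ) ≤ 1 / (t m) ^ 2)
    (he : 0 < e) (h4e : 4 * e ≤ γ)
    (hs1 : 32 * Cm * e ≤ bs * (1 - θ))
    (hs2 : e ^ 2 * (1 / gs ^ 2 + Cm * γ / (1 - θ) ^ 2 + (2 * Cm / ((1 - θ) * bs)) ^ 2) ≤ 3 / 4)
    (hs2' : 4 * e ^ 2 * (Cm * γ / (1 - θ) ^ 2 + (8 * Cm / ((1 - θ) * bs)) ^ 2) ≤ 1 / 2)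
    (hs4 : 512 * Cm * e ^ 3 ≤ (1 - θ) ^ 2) : ∀ n : ℕ, solution B e n = (fun g => solution B g 1)^[n] e := by
  have h1θ : 0 < 1 - θ := by linarith
  have h2e : 2 * e ≤ γ := by linarith
  have hs1e : 4 * Cm * e ≤ bs * (1 - θ) := by nlinarith [mul_nonneg hCm he.le]
  have hs4e : 64 * Cm * e ^ 3 ≤ (1 - θ) ^ 2 := by nlinarith [mul_nonneg hCm (pow_nonneg he.le 3)]
  obtain ⟨-, hsf, -, -⟩ := memFlow_solution_of_reference hB hCm hθ0 hθ1 hbs hta hts htf hprof he h2e hs1e hs2 hs4e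
  intro n
  induction n with
  | zero =>
    rw [Function.iterate_zero_apply]
    exact hsf.1
  | succ n ih =>
    rw [Function.iterate_succ_apply', ← ih]
    exact ((solution_cocycle_of_reference hB hCm hθ0 hθ1 hbs hta hts htf hprof he h4e hs1 hs2 hs2' hs4 n).1 1).symm

/-! ## §37 Eventual well-posedness along EVERY asymptotically free trajectory — no smallness -/

/-- **ASYMPTOTIC FREEDOM MAKES THE RE-PINNED FLOW WELL POSED DEEP IN THE ULTRAVIOLET, ALONG EVERY AF TRAJECTORY, WITH NO SMALLNESS ASKED OF ANYTHING.**  `B` with a memory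
profile `(C_m, θ)` on an ARBITRARY box ]0, γ]^ℕ (0 ≤ θ < 1, C_m ≥ 0); ANY box solution t of `MemFlow B g* t` (any pin g*) with an asymptotically free profile
`1∕t_a² + β*·m ≤ 1∕t(m)²` (ANY t_a > 0, ANY β* > 0).  THEN there is a physical scale n₀ such that for EVERY n ≥ n₀: (i) every box solution of the flow re-pinned at the
trajectory's own running value, `MemFlow B (t n) ·`, IS the tail `(t(n), t(n+1), …)`; (ii) node U2's `solution B (t n)` is that tail; (iii) node U2's lattice-free Picard
iterates from the constant history t(n) converge to it, `iterate B (t n) k m → t(n + m)`.  The decay `t_a^{(n)} = 1∕√(1∕t_a² + β*n) → 0` of the tail's reference scale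
meets the threshold of parts 23–24 (`repin_threshold_exists`, `exists_tail_scale_le`).  [cite: Balaban1987RG1, Thm 2 (0.31) p.259 with (0.20) p.256 and p.298] -/
theorem eventually_wellPosed_tail {B : (ℕ → ℝ) → ℝ} {Cm θ γ bs ta gs : ℝ} {t : ℕ → ℝ}
    (hB : MemoryProfile Cm θ γ B) (hCm : 0 ≤ Cm) (hθ0 : 0 ≤ θ) (hθ1 : θ < 1) (hbs : 0 < bs) (hta : 0 < ta)
    (hts : SeqBox γ t) (htf : MemFlow B gs t) (hprof : ∀ m : ℕ, 1 / ta ^ 2 + bs * (m : ℝ) ≤ 1 / (t m) ^ 2) :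
    ∃ n₀ : ℕ, ∀ n, n₀ ≤ n →
      (∀ h : ℕ → ℝ, SeqBox γ h → MemFlow B (t n) h → h = fun j => t (n + j)) ∧
      (solution B (t n) = fun j => t (n + j)) ∧
      ∀ m : ℕ, Tendsto (fun k => iterate B (t n) k m) atTop (𝓝 (t (n + m))) := by
  have hγ : 0 < γ := (hts 0).1.trans_le (hts 0).2
  have h1θ : 0 < 1 - θ := by linarith
  obtain ⟨δ, hδ, hthr⟩ := repin_threshold_exists (γ := γ) hCm hθ1 hγ hbs
  obtain ⟨n₀, hn₀⟩ := exists_tail_scale_le hta hbs hδ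
  refine ⟨n₀, fun n hn => ?_⟩
  have hτ := one_div_sprof_pos hta hbs.le n
  obtain ⟨h2τ, hr1, hr2, hr4⟩ := hthr (1 / sprof ta bs n) hτ (hn₀ n hn)
  have hr4' : 16 * Cm * (1 / sprof ta bs n) ^ 3 < (1 - θ) ^ 2 := by
    have : 0 < (1 - θ) ^ 2 := by positivity
    nlinarith [mul_nonneg hCm (pow_nonneg hτ.le 3)]
  have hts' := seqBox_shift hts n
  have htf' := memFlow_tail htf n
  have hprof' := tail_profile hta hbs.le hprof n
  exact ⟨fun h hh hf => memFlow_unique_at_reference hB hCm hθ0 hθ1 hbs hτ hts' htf' hprof' hh hf hr1 hr2 hr4',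
    solution_eq_at_reference hB hCm hθ0 hθ1 hbs hτ hts' htf' hprof' h2τ hr1 hr2 hr4,
    fun m => tendsto_iterate_at_reference hB hCm hθ0 hθ1 hbs hτ hts' htf' hprof' h2τ hr1 hr2 hr4 m⟩

end

end Summit.QuantumFields.BalabanUV.Beta.EriceFlowEnclosureB12AsPrintedHistoryContagionShiftFlowRepinTail
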